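import Summits.QuantumFields.BalabanUV.Beta.RemainderExplicitCarrier

/-!
# Beta / RemainderExplicitEnd — BINDER-OWNERS row D4, ROAD P3 (co-owner #3, unit `b2b-balaban-beta-d4-p3`): THE END OF THE ROAD WITH
# (E) AND (V) DISCHARGED — «(D4) ⇐ (R) ∧ (E) ∧ (V) ∧ numerics» BECOMES «(D4) ⇐ (R) ∧ numerics» FOR THE EXPLICIT CARRIER `carrierBal`

HONEST FRAMING (page 1 of everything the β sub-cell writes): discharging `BetaPertH` makes Bałaban's UV stability
UNCONDITIONAL — a real constructive-QFT result; it is NOT the continuum limit and NOT the Clay problem.  HONEST DEPENDENCY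
(verbatim): «continuum YM on T⁴ ⇐ BetaPertH ∧ nine spine estimates (0/9 proved); BetaPertH ⇐ (D1) ∧ (D4) ∧ CAP+tail;
G-an2-4 gates asym, D1 and NE2/3/4.»  NOT IN PRINT; OUR BOOKKEEPING: `RemainderExplicitRoad.ResidualChain.abs_beta1_le` with its
hypotheses (E) `∀ k, (𝔈 k).Decay B₃ c.δ₀` and (V) `∀ k, (𝔈 k).Limit` SUPPLIED by `RemainderExplicitCarrier.exists_decay_carrierBal` /
`limit_carrierBal` for `𝔈 := fun k ↦ carrierBal Lc k Mc Nn hN μ ν`.  What remains, exactly: the ONE residual printed input (R)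
`ResidualChain 4 Mc μ ν Sβ γ c ℓ α₂ (fun k ↦ carrierBal …)` (Bałaban's small-field step objects, Lemma 3 (2.38), the (4.4) seam and
analyticity, the (4.35) representation ALONG THE EXPLICIT TEST CONFIGURATIONS, the (1.7) locality — size XL, unowned, `RemainderExplicitRoad`
§2–§3), the numeric conditions `CondsL`, `R22gen`, three signs, and `c.δ₀ ≤ δ₀⋆` (the chain's rate below the explicit carrier's rate —
a free choice of the chain's constants).  D4 DISCHARGE: NO DATE (the residual).  No cited fact; nothing about Bałaban's densities is
asserted.  NOT `BetaPertH`, NOT continuum, NOT Clay, NOT summit progress.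

ABSOLUTE RULE (cell charter, verbatim): "No internally-minted statement may enter as a cited fact. Every hypothesis is
either kernel-proved in this package or a verbatim quotation of a PUBLISHED theorem with page reference. The manuscript(s)
under audit are NOT citable for their own disputed steps — they are the thing under adjudication; programme-internal
(2001/route/tribunal) claims are never citable."
-/

noncomputable section

open Filter
open Literature.MathematicalPhysics.QuantumFieldTheory.Balaban1983to89
open Literature.MathematicalPhysics.QuantumFieldTheory.Balaban1983to89.Beta
open FlowStep FlowStepRuns DagBinding
open Beta.RemainderChain (RemainderConst)
open Beta.RemainderChainLattice (CondsL SignsL remCoeffL)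
open Beta.OneStepKernelFamily (TbalOf D1Drift endpointExistence_of_D1Drift)
open Beta.OneStepResolventKernel (JetData)
open B12Beta (secondMoment)
open Summit.QuantumFields.BalabanUV.Beta.RemainderExplicitRoad (ExplicitCarrier ResidualChain)
open Summit.QuantumFields.BalabanUV.Beta.RemainderExplicitCarrier (carrierBal exists_decay_carrierBal limit_carrierBal)

namespace Summit.QuantumFields.BalabanUV.Beta.RemainderExplicitEnd

variable (Lc : ℕ) [NeZero Lc] (Mc : ℕ) [NeZero Mc] (Nn : ℕ → ℕ) [∀ n, NeZero (Nn n)]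

/-- **THE SCALE-INDEXED FAMILY OF EXPLICIT CARRIERS** of road P3: at scale `k` the carrier of level `j = k` (block side `Lc^{k+1}`). [folklore] -/
def carrierFamily (hN : Tendsto Nn atTop atTop) (μ ν : Fin 4) : ℕ → ExplicitCarrier 4 Mc :=
  fun k => carrierBal Lc k Mc Nn hN μ ν

/-- [folklore] **THE END OF ROAD P3 WITH (E) AND (V) DISCHARGED — `hrem` FROM THE RESIDUAL ALONE**: there are explicit constants
`δ₀⋆ > 0`, `B₃ ≥ 0` (those of `exists_decay_carrierBal`: ONE pair for every scale) such that for every β-family with one-loop split,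
every residual printed input (R) RELATIVE TO THE EXPLICIT CARRIER FAMILY, the numeric conditions `CondsL 4 c ℓ`, `c.R22gen ℓ`, the
signs `0 ≤ C₃ε₁`, `0 < α₂`, `0 < c.δ₀` and the rate choice `c.δ₀ ≤ δ₀⋆`:
`|β¹_{k+1}(g_0,…,g_k)| ≤ ε₁·K_rem,L(4, Mc, c, α₂, B₃)` on every box — `RemainderConst Sβ γ (c.ε₁ · remCoeffL 4 Mc c α₂ B₃)`. -/
theorem exists_remainderConst_of_residualChain (hN : Tendsto Nn atTop atTop) (μ ν : Fin 4) :
    ∃ δ₀ B₃ : ℝ, 0 < δ₀ ∧ 0 ≤ B₃ ∧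
      ∀ {β : HBeta} {S : B12Beta.OneLoopSplit β} {γ : ℝ} {c : B13.Consts} {ℓ α₂ : ℝ}
        (_R : ResidualChain 4 Mc μ ν S γ c ℓ α₂ (carrierFamily Lc Mc Nn hN μ ν)),
        CondsL 4 c ℓ → c.R22gen ℓ → 0 ≤ c.C3act * c.ε₁ → 0 < α₂ → 0 < c.δ₀ → c.δ₀ ≤ δ₀ →
          RemainderConst S γ (c.ε₁ * remCoeffL 4 Mc c α₂ B₃) := by
  obtain ⟨δ₀, B₃, hδ, hB, hdec⟩ := exists_decay_carrierBal Lc Mc μ ν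
  refine ⟨δ₀, B₃, hδ, hB, ?_⟩
  intro β S γ c ℓ α₂ R hC h22 hA hα₂ hδpos hδle
  have hE : ∀ k, (carrierFamily Lc Mc Nn hN μ ν k).Decay B₃ c.δ₀ :=
    fun k => (hdec k Nn hN).mono _ le_rfl hB hδle hδpos.le
  have hV : ∀ k, (carrierFamily Lc Mc Nn hN μ ν k).Limit := fun k => limit_carrierBal Lc k Mc Nn hN μ ν
  exact R.abs_beta1_le hE hV hC h22 ⟨hA, hα₂, hB, hδpos⟩ (by norm_num)

/-- [folklore] **THE WALL'S END WITH ITS (D4) PAIR FROM ROAD P3 AND (E), (V) DISCHARGED**: `OneStepKernelFamily.endpointExistence_of_D1Drift`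
with `hrem` supplied by the residual (R) relative to the explicit carrier family; `hr` stays the printed-type restriction on ε₁. -/
theorem endpointExistence_of_residualChain_carrierBal (hN : Tendsto Nn atTop atTop) {β : HBeta} {Cn : B12.Construction}
    (hgen : ForwardGenerated Cn β) (Sβ : B12Beta.OneLoopSplit β) (Js : ℕ → JetData 3 Lc) {N : ℝ} {μ ν : Fin 4}
    (hβ : ∀ j, Sβ.β0 j = secondMoment (TbalOf Lc Js j) μ ν) (hD : D1Drift Lc Js N μ ν) {γ₀ : ℝ} (hγ₀ : 0 < γ₀)
    {c : B13.Consts} {ℓ α₂ : ℝ} (hC : CondsL 4 c ℓ) (h22 : c.R22gen ℓ) (hA : 0 ≤ c.C3act * c.ε₁) (hα₂ : 0 < α₂)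
    (hδpos : 0 < c.δ₀) (hcont : BetaContH γ₀ β) :
    ∃ δ₀ B₃ : ℝ, 0 < δ₀ ∧ 0 ≤ B₃ ∧
      (ResidualChain 4 Mc μ ν Sβ γ₀ c ℓ α₂ (carrierFamily Lc Mc Nn hN μ ν) → c.δ₀ ≤ δ₀ →
        c.ε₁ * remCoeffL 4 Mc c α₂ B₃ ≤ B12Normalization.stepBal N Lc → EndpointExistence Cn) := by
  obtain ⟨δ₀, B₃, hδ, hB, h⟩ := exists_remainderConst_of_residualChain Lc Mc Nn hN μ ν
  exact ⟨δ₀, B₃, hδ, hB, fun R hδle hr =>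
    endpointExistence_of_D1Drift hgen Sβ Js hβ hD hγ₀ (h R hC h22 hA hα₂ hδpos hδle) hr hcont⟩

end Summit.QuantumFields.BalabanUV.Beta.RemainderExplicitEnd

end
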